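import Summits.AtomisticToContinuum.Crystallization.Theorems.ChessboardParticlePlanesPeriodicWindowsBarlowOfLevels

/-!
# Crux `PeriodicWindows` (stmt-AtomisticToContinuum-3240), line `dense-laminar-hull` — stub P3b1
# `stub_layerData` (aligned triangular layers ⇒ explicit layer data; bookkeeping)

A rooted (`0 ∈ Z`), `ρ₀`-dense, exactly laminar (distinct heights `≥ 3/4` apart) set `Z ⊆ ℝ³`
all of whose layers `{q ∈ Z | q 2 = p 2}` are translates `p + ℤu + ℤv` of ONE horizontal
triangular lattice (`u 2 = v 2 = 0`, `‖u‖ = ‖v‖ = a`, `⟪u, v⟫ = a²/2`) is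
`B '' {i • v₁(a) + j • v₂(a) + δ m + z m • e₃}` for a horizontal linear isometry `B` (it preserves
the third coordinate), horizontal offsets `δ : ℤ → ℝ³` (`δ 0 = 0`) and strictly increasing
heights `z : ℤ → ℝ` (`z 0 = 0`, consecutive gaps in `[3/4, 2ρ₀]`).

* `exists_isLeast_gt`, `exists_isGreatest_lt` — in a `3/4`-separated, `ρ`-dense `H ⊆ ℝ` every
  real `t` has a least element of `H` above it, at most `t + 2ρ`, and a greatest one below it
  (the infimum of `H ∩ (t, ∞)` is attained, by separation);
* `exists_enumeration` — such an `H ∋ 0` is the range of a strictly increasing `z : ℤ → ℝ`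
  with `z 0 = 0` and consecutive gaps in `[3/4, 2ρ]`: the `ℤ`-orbit of `0` under the
  "next element" permutation of `H`;
* `stub_layerData` — heights `H = {p 2 | p ∈ Z}`; `B` is the frame isometry of
  `PeriodicWindowsSketch.exists_linearIsometry_frame` (`B v₁ = u`, `B v₂ = v`, `(B p) 2 = p 2`);
  `δ m = B⁻¹ pₘ - z m • e₃` for a point `pₘ ∈ Z` at height `z m` (`p₀ = 0`); the set identity is
  the layer hypothesis at the points `pₘ`.

No energetics, no hull, no recurrence. All elementary. [folklore]
-/

noncomputable section

namespace Summit.AtomisticToContinuum.Crystallization.Theorems.PeriodicWindowsDenseLaminarHull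

open Literature.MathematicalPhysics.StatisticalMechanics Filter Metric

/-! ## Separated relatively dense subsets of `ℝ` -/

/-- In a `3/4`-separated, `ρ`-dense `H ⊆ ℝ`, above every real `t` there is a least element of
`H`, and it is at most `t + 2ρ` (density at `t + ρ + ε` for every `ε > 0`). -/
private theorem exists_isLeast_gt {H : Set ℝ} {ρ : ℝ}
    (hsep : ∀ s ∈ H, ∀ t ∈ H, s ≠ t → (3 : ℝ) / 4 ≤ |s - t|)
    (hdense : ∀ c : ℝ, ∃ t ∈ H, |t - c| ≤ ρ) (t : ℝ) :
    ∃ t', IsLeast {s ∈ H | t < s} t' ∧ t' ≤ t + 2 * ρ := by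
  have hne : ∀ ε : ℝ, 0 < ε → ∃ s ∈ H, t < s ∧ s ≤ t + 2 * ρ + ε := by
    intro ε hε
    obtain ⟨s, hs, hsc⟩ := hdense (t + ρ + ε)
    rw [abs_le] at hsc
    exact ⟨s, hs, by linarith, by linarith⟩
  obtain ⟨s₀, hs₀, hts₀, -⟩ := hne 1 one_pos
  have hSne : ({s ∈ H | t < s} : Set ℝ).Nonempty := ⟨s₀, hs₀, hts₀⟩
  have hSbdd : BddBelow {s ∈ H | t < s} := ⟨t, fun s hs => hs.2.le⟩
  obtain ⟨s₁, hs₁, hs₁lt⟩ := exists_lt_of_csInf_lt hSne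
    (lt_add_of_pos_right (sInf {s ∈ H | t < s}) (by norm_num : (0 : ℝ) < 3 / 8))
  have hleast : IsLeast {s ∈ H | t < s} s₁ := by
    refine ⟨hs₁, fun s hs => le_of_not_gt fun hlt => ?_⟩
    have h1 : sInf {s ∈ H | t < s} ≤ s := csInf_le hSbdd hs
    have h2 := hsep s hs.1 s₁ hs₁.1 hlt.ne
    rw [abs_sub_comm, abs_of_pos (sub_pos.2 hlt)] at h2
    linarith
  refine ⟨s₁, hleast, le_of_forall_pos_le_add fun ε hε => ?_⟩
  obtain ⟨s, hs, hts, hsle⟩ := hne ε hε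
  exact (hleast.2 ⟨hs, hts⟩).trans hsle

/-- In a `3/4`-separated, `ρ`-dense `H ⊆ ℝ`, below every real `t` there is a greatest element of
`H` (the supremum of `H ∩ (-∞, t)` is attained, by separation). -/
private theorem exists_isGreatest_lt {H : Set ℝ} {ρ : ℝ}
    (hsep : ∀ s ∈ H, ∀ t ∈ H, s ≠ t → (3 : ℝ) / 4 ≤ |s - t|)
    (hdense : ∀ c : ℝ, ∃ t ∈ H, |t - c| ≤ ρ) (t : ℝ) :
    ∃ t', IsGreatest {s ∈ H | s < t} t' := by
  obtain ⟨s₀, hs₀, hsc⟩ := hdense (t - ρ - 1)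
  rw [abs_le] at hsc
  have hSne : ({s ∈ H | s < t} : Set ℝ).Nonempty := ⟨s₀, hs₀, by linarith⟩
  have hSbdd : BddAbove {s ∈ H | s < t} := ⟨t, fun s hs => hs.2.le⟩
  obtain ⟨s₁, hs₁, hs₁lt⟩ := exists_lt_of_lt_csSup hSne
    (sub_lt_self (sSup {s ∈ H | s < t}) (by norm_num : (0 : ℝ) < 3 / 8))
  refine ⟨s₁, hs₁, fun s hs => le_of_not_gt fun hlt => ?_⟩
  have h1 : s ≤ sSup {s ∈ H | s < t} := le_csSup hSbdd hs
  have h2 := hsep s hs.1 s₁ hs₁.1 hlt.ne'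
  rw [abs_of_pos (sub_pos.2 hlt)] at h2
  linarith

/-- **Enumeration of a separated relatively dense subset of `ℝ`.** A `3/4`-separated, `ρ`-dense
`H ∋ 0` in `ℝ` is the range of a strictly increasing `z : ℤ → ℝ` with `z 0 = 0` and consecutive
gaps in `[3/4, 2ρ]`: `z` is the `ℤ`-orbit of `0` under the permutation "next element of `H`"
(inverse "previous element"), and every `t ∈ H` is hit since the largest `m` with `z m ≤ t` has
`z m = t` (no element of `H` lies strictly between `z m` and `z (m + 1)`). -/
private theorem exists_enumeration {H : Set ℝ} {ρ : ℝ} (h0 : (0 : ℝ) ∈ H)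
    (hsep : ∀ s ∈ H, ∀ t ∈ H, s ≠ t → (3 : ℝ) / 4 ≤ |s - t|)
    (hdense : ∀ c : ℝ, ∃ t ∈ H, |t - c| ≤ ρ) :
    ∃ z : ℤ → ℝ, z 0 = 0 ∧ StrictMono z ∧ (∀ m : ℤ, (3 : ℝ) / 4 ≤ z (m + 1) - z m) ∧
      (∀ m : ℤ, z (m + 1) - z m ≤ 2 * ρ) ∧ (∀ m : ℤ, z m ∈ H) ∧ ∀ t ∈ H, ∃ m : ℤ, z m = t := by
  choose nx hnx hnxle using exists_isLeast_gt hsep hdense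
  choose pv hpv using exists_isGreatest_lt hsep hdense
  have nx_mem : ∀ t, nx t ∈ H := fun t => (hnx t).1.1
  have lt_nx : ∀ t, t < nx t := fun t => (hnx t).1.2
  have nx_le : ∀ t, ∀ s ∈ H, t < s → nx t ≤ s := fun t s hs hts => (hnx t).2 ⟨hs, hts⟩
  have pv_mem : ∀ t, pv t ∈ H := fun t => (hpv t).1.1
  have pv_lt : ∀ t, pv t < t := fun t => (hpv t).1.2
  have le_pv : ∀ t, ∀ s ∈ H, s < t → s ≤ pv t := fun t s hs hst => (hpv t).2 ⟨hs, hst⟩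
  have nx_pv : ∀ t ∈ H, nx (pv t) = t := fun t ht => by
    rcases (nx_le (pv t) t ht (pv_lt t)).lt_or_eq with hlt | heq
    · exact absurd (le_pv t _ (nx_mem _) hlt) (not_le.2 (lt_nx _))
    · exact heq
  have pv_nx : ∀ t ∈ H, pv (nx t) = t := fun t ht => by
    rcases (le_pv (nx t) t ht (lt_nx t)).lt_or_eq with hlt | heq
    · exact absurd (nx_le t _ (pv_mem _) hlt) (not_le.2 (pv_lt _))
    · exact heq.symm
  -- the "next element" permutation of `H` and the `ℤ`-orbit of `0`
  let e : Equiv.Perm H := ⟨fun t => ⟨nx t, nx_mem t⟩, fun t => ⟨pv t, pv_mem t⟩,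
    fun t => Subtype.ext (pv_nx t t.2), fun t => Subtype.ext (nx_pv t t.2)⟩
  obtain ⟨z, hz⟩ : ∃ z : ℤ → ℝ, ∀ m, z m = ((e ^ m) ⟨0, h0⟩ : H) := ⟨_, fun _ => rfl⟩
  have hz0 : z 0 = 0 := by rw [hz, zpow_zero]; rfl
  have hz_mem : ∀ m, z m ∈ H := fun m => by rw [hz]; exact Subtype.coe_prop _
  have hz_succ : ∀ m, z (m + 1) = nx (z m) := fun m => by
    rw [hz, hz, add_comm, zpow_one_add]; rfl
  have hgap : ∀ m, (3 : ℝ) / 4 ≤ z (m + 1) - z m := fun m => by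
    have h1 := hsep _ (nx_mem (z m)) _ (hz_mem m) (lt_nx (z m)).ne'
    rw [abs_of_pos (sub_pos.2 (lt_nx (z m)))] at h1
    rwa [hz_succ]
  have hgap' : ∀ m, z (m + 1) - z m ≤ 2 * ρ := fun m => by
    rw [hz_succ]; linarith [hnxle (z m)]
  have hmono : StrictMono z := strictMono_int_of_lt_succ fun m => by linarith [hgap m]
  refine ⟨z, hz0, hmono, hgap, hgap', hz_mem, fun t ht => ?_⟩
  -- surjectivity onto `H`
  have hup : ∀ n : ℕ, (3 : ℝ) / 4 * n ≤ z n := fun n => by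
    induction n with
    | zero => simp [hz0]
    | succ n ih => have := hgap n; push_cast; linarith
  have hdn : ∀ n : ℕ, z (-(n : ℤ)) ≤ -((3 : ℝ) / 4 * n) := fun n => by
    induction n with
    | zero => simp [hz0]
    | succ n ih =>
      have h1 := hgap (-((n + 1 : ℕ) : ℤ))
      rw [show -((n + 1 : ℕ) : ℤ) + 1 = -(n : ℤ) by omega] at h1
      push_cast at h1 ⊢
      linarith
  obtain ⟨n, hn⟩ := exists_nat_gt (2 * |t|)
  have ht_le := le_abs_self t
  have ht_ge := neg_abs_le t
  have habs := abs_nonneg t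
  have hlow : z (-(n : ℤ)) ≤ t := by linarith [hdn n]
  have hhigh : t < z n := by linarith [hup n]
  obtain ⟨m, hm, hmax⟩ := Int.exists_greatest_of_bdd (P := fun m : ℤ => z m ≤ t)
    ⟨n, fun m hm => (hmono.lt_iff_lt.1 (hm.trans_lt hhigh)).le⟩ ⟨-(n : ℤ), hlow⟩
  have hm1 : t < z (m + 1) := by
    by_contra hle
    have := hmax (m + 1) (not_lt.1 hle)
    omega
  rcases hm.lt_or_eq with hlt | heq
  · have h1 := nx_le (z m) t ht hlt
    rw [← hz_succ] at h1
    exact absurd hm1 (not_lt.2 h1)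
  · exact ⟨m, heq⟩

/-! ## The stub -/

/-- **P3b1 (layer data; bookkeeping, no energetics).** A rooted, `ρ₀`-dense, exactly laminar
set `Z ⊆ ℝ³` all of whose layers are translates `p + ℤu + ℤv` of one horizontal triangular
lattice (spacing `a`) is, up to a HORIZONTAL linear isometry `B` (it preserves the third
coordinate), the general layered set with data `(δ, z)`: layer `m ∈ ℤ` is `ℤ v₁(a) + ℤ v₂(a) + δ m`
at height `z m`, the lateral offsets `δ m` horizontal with `δ 0 = 0`, the heights `z` strictly
increasing with `z 0 = 0` and consecutive gaps in `[3/4, 2ρ₀]`. Route: the heights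
`{p 2 | p ∈ Z} ∋ 0` are `3/4`-separated (laminarity) and `ρ₀`-dense in `ℝ` (density at the
points `(0, 0, t)`, coordinates being `1`-Lipschitz), hence enumerated by `exists_enumeration`;
`B` is the frame isometry of `PeriodicWindowsSketch.exists_linearIsometry_frame` (`B v₁(a) = u`,
`B v₂(a) = v`, `(B p) 2 = p 2`) made an equivalence by `toLinearIsometryEquiv rfl`;
`δ m := B⁻¹ pₘ - z m • e₃` for a chosen point `pₘ ∈ Z` at height `z m` (`p₀ = 0`), so that
`B (i • v₁ + j • v₂ + δ m + z m • e₃) = pₘ + i • u + j • v`, and the set identity is the layer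
hypothesis at the points `pₘ`. [folklore] -/
theorem stub_layerData : ∀ ρ₀ : ℝ, 0 < ρ₀ →
    ∀ Z : Set (EuclideanSpace ℝ (Fin 3)), (0 : EuclideanSpace ℝ (Fin 3)) ∈ Z →
    (∀ c : EuclideanSpace ℝ (Fin 3), ∃ p ∈ Z, dist p c ≤ ρ₀) →
    (∀ p ∈ Z, ∀ q ∈ Z, p 2 ≠ q 2 → (3 : ℝ) / 4 ≤ |p 2 - q 2|) →
    ∀ a : ℝ, 0 < a → ∀ u v : EuclideanSpace ℝ (Fin 3), u 2 = 0 → v 2 = 0 → ‖u‖ = a → ‖v‖ = a →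
    inner ℝ u v = a ^ 2 / 2 →
    (∀ p ∈ Z, {q | q ∈ Z ∧ q 2 = p 2} = {q | ∃ i j : ℤ, q = p + (i : ℝ) • u + (j : ℝ) • v}) →
    ∃ (B : EuclideanSpace ℝ (Fin 3) ≃ₗᵢ[ℝ] EuclideanSpace ℝ (Fin 3))
      (δ : ℤ → EuclideanSpace ℝ (Fin 3)) (z : ℤ → ℝ),
      (∀ p : EuclideanSpace ℝ (Fin 3), (B p) 2 = p 2) ∧ (∀ m : ℤ, (δ m) 2 = 0) ∧ δ 0 = 0 ∧
      z 0 = 0 ∧ StrictMono z ∧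
      (∀ m : ℤ, (3 : ℝ) / 4 ≤ z (m + 1) - z m) ∧ (∀ m : ℤ, z (m + 1) - z m ≤ 2 * ρ₀) ∧
      Z = (fun p => B p) '' {p | ∃ m i j : ℤ, p = ((i : ℝ) • triangularVec₁ a) +
        ((j : ℝ) • triangularVec₂ a) + δ m + (z m • layerNormal 1)} := by
  intro ρ₀ _ Z h0 hdense hlam a ha u v hu2 hv2 hu hv huv hlayers
  -- (1) the heights `H = {p 2 | p ∈ Z}`: rooted, `3/4`-separated, `ρ₀`-dense, hence enumerated
  set H : Set ℝ := {t | ∃ p ∈ Z, p 2 = t}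
  have hH0 : (0 : ℝ) ∈ H := ⟨0, h0, rfl⟩
  have hHsep : ∀ s ∈ H, ∀ t ∈ H, s ≠ t → (3 : ℝ) / 4 ≤ |s - t| := by
    rintro s ⟨p, hp, rfl⟩ t ⟨q, hq, rfl⟩ hne
    exact hlam p hp q hq hne
  have hHdense : ∀ c : ℝ, ∃ t ∈ H, |t - c| ≤ ρ₀ := by
    intro c
    obtain ⟨p, hp, hpc⟩ := hdense (EuclideanSpace.single (2 : Fin 3) c)
    refine ⟨p 2, ⟨p, hp, rfl⟩, ?_⟩
    have h1 := PiLp.dist_apply_le p (EuclideanSpace.single (2 : Fin 3) c) 2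
    rw [Real.dist_eq] at h1
    simpa using h1.trans hpc
  obtain ⟨z, hz0, hzmono, hgap, hgap', hzH, hzsurj⟩ := exists_enumeration hH0 hHsep hHdense
  -- (2) the frame isometry
  obtain ⟨A, hA⟩ := PeriodicWindowsSketch.exists_linearIsometry_frame ha hu2 hv2 hu hv huv
  obtain ⟨B, hBA⟩ : ∃ B : EuclideanSpace ℝ (Fin 3) ≃ₗᵢ[ℝ] EuclideanSpace ℝ (Fin 3),
      ∀ x, B x = A x := ⟨A.toLinearIsometryEquiv rfl, fun _ => rfl⟩
  have hs3 : Real.sqrt 3 ≠ 0 := (Real.sqrt_pos.2 (by norm_num : (0 : ℝ) < 3)).ne'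
  have ha' : a ≠ 0 := ha.ne'
  have hB2 : ∀ p : EuclideanSpace ℝ (Fin 3), (B p) 2 = p 2 := fun p => by
    rw [hBA, hA]
    simp [hu2, hv2]
  have hBsymm2 : ∀ q : EuclideanSpace ℝ (Fin 3), (B.symm q) 2 = q 2 := fun q => by
    have h1 := hB2 (B.symm q)
    rw [LinearIsometryEquiv.apply_symm_apply] at h1
    exact h1.symm
  have hBu : B (triangularVec₁ a) = u := by
    rw [hBA, hA]
    simp [triangularVec₁, smul_smul, mul_inv_cancel₀ ha']
  have hBv : B (triangularVec₂ a) = v := by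
    rw [hBA, hA]
    simp only [triangularVec₂, PiLp.toLp_apply, Matrix.cons_val_zero, Matrix.cons_val_one,
      Matrix.cons_val, zero_smul, add_zero, smul_smul]
    have e1 : a / 2 * a⁻¹ = 1 / 2 := by field_simp
    have e2 : a * √3 / 2 * (a * √3)⁻¹ = 1 / 2 := by field_simp
    rw [e1, e2]
    module
  -- (3) the data: a point of `Z` on each level (`0` on level `0`), and the offsets
  have hpt : ∀ m : ℤ, ∃ p : EuclideanSpace ℝ (Fin 3), p ∈ Z ∧ p 2 = z m ∧ (m = 0 → p = 0) := by
    intro m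
    by_cases hm : m = 0
    · exact ⟨0, h0, by rw [hm, hz0]; rfl, fun _ => rfl⟩
    · obtain ⟨p, hp, hp2⟩ := hzH m
      exact ⟨p, hp, hp2, fun h => absurd h hm⟩
  choose pt hptZ hpt2 hpt0 using hpt
  obtain ⟨δ, hδ⟩ : ∃ δ : ℤ → EuclideanSpace ℝ (Fin 3),
      ∀ m, δ m = B.symm (pt m) - z m • layerNormal 1 := ⟨_, fun _ => rfl⟩
  have hn2 : (layerNormal 1 : EuclideanSpace ℝ (Fin 3)) 2 = 1 := by simp [layerNormal]
  have hBpt : ∀ m i j : ℤ, B (((i : ℝ) • triangularVec₁ a) + ((j : ℝ) • triangularVec₂ a) + δ m +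
      (z m • layerNormal 1)) = pt m + (i : ℝ) • u + (j : ℝ) • v := fun m i j => by
    simp only [hδ, map_add, map_sub, LinearIsometryEquiv.map_smul,
      LinearIsometryEquiv.apply_symm_apply, hBu, hBv]
    abel
  refine ⟨B, δ, z, hB2, fun m => ?_, ?_, hz0, hzmono, hgap, hgap', Set.Subset.antisymm ?_ ?_⟩
  · -- the offsets are horizontal
    rw [hδ, PiLp.sub_apply, PiLp.smul_apply, hBsymm2, hpt2, hn2, smul_eq_mul, mul_one, sub_self]
  · -- `δ 0 = 0`
    rw [hδ, hpt0 0 rfl, hz0, map_zero, zero_smul, sub_zero]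
  · -- `Z ⊆ B '' {…}`: a point of `Z` lies on the level of some `pₘ`
    intro q hq
    obtain ⟨m, hm⟩ := hzsurj (q 2) ⟨q, hq, rfl⟩
    have h1 : q ∈ {q' | q' ∈ Z ∧ q' 2 = (pt m) 2} := ⟨hq, by rw [hpt2, hm]⟩
    rw [hlayers (pt m) (hptZ m)] at h1
    obtain ⟨i, j, hq'⟩ := h1
    exact ⟨_, ⟨m, i, j, rfl⟩, by rw [hq']; exact hBpt m i j⟩
  · -- `B '' {…} ⊆ Z`: the level of `pₘ` lies in `Z`
    rintro _ ⟨p, ⟨m, i, j, rfl⟩, rfl⟩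
    have h1 : pt m + (i : ℝ) • u + (j : ℝ) • v ∈
        {q' | ∃ i j : ℤ, q' = pt m + (i : ℝ) • u + (j : ℝ) • v} := ⟨i, j, rfl⟩
    rw [← hlayers (pt m) (hptZ m)] at h1
    show B _ ∈ Z
    rw [hBpt]
    exact h1.1

end Summit.AtomisticToContinuum.Crystallization.Theorems.PeriodicWindowsDenseLaminarHull

end
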